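import Summits.CriticalPhenomena.CardyFormulaZ2.Theorems.HalfPlaneOneArmThird.Negative.Basics
import Literature.Probability.Percolation.HalfPlaneOneArmQuasiMultiplicativity
import Literature.Probability.Percolation.HalfPlaneArmAxisInputs
import Literature.Probability.Percolation.LatticeSymmetry
import HarnessLib

/-!
# Hardness certificate of line `rainbow-monomials-in-excursion-kernels` (crux `BoundaryDefectGaussianR`,
# stmt-CriticalPhenomena-14132), Stub H3: a boundary two-point connection contains two disjoint
# half-plane arms

Critical bond percolation on `ℤ²` (`bondPercolation (zdGraph 2) half`). For `n : ℕ` let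
`V_n = [-12(n+1), 12(n+1)]²`, `u = (-4(n+1), -12(n+1))`, `w = (4(n+1), -12(n+1))` (two points of the
bottom row of `V_n`) and `m = 4n + 3`. We prove

  `P[u ↔ w inside V_n] ≤ θ(m)²`,

where `θ(m) = prob half m` is the half-plane one-arm probability of crux 6 (`HalfPlaneOneArmThird`):
the probability that `0` is joined inside the half-box `[-m, m] × [0, m]` to its outer boundary.

Notation (local): for a base point `b` and a radius `m`, `hb[b, m] = {b 1 ≤ v 1, ν_b v ≤ m}` is the
half-box of half-plane radius `m` about `b` for the `1`-Lipschitz half-plane norm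
`ν_b v = max |v 0 - b 0| (v 1 - b 1)`, `hl[b, m] = {ν_b = m}` its outer level, and
`HArm[b, m] = openCrossing hb[b, m] {b} hl[b, m]` the arm event from `b` to the level `m`.

* `clas_conn_mem_arm` — FIRST EXIT (deterministic): an open path from `u` inside a region lying above
  the row of `u` to a point at half-plane distance `≥ m` from `u`, stopped at its first visit to the
  level `m`, is an arm in `hb[u, m]` (`exists_openConnIn_le_level`);
* `clas_real_arm_inter` — INDEPENDENCE: arms in disjoint half-boxes are determined by disjoint sets of
  edges, hence independent under the product measure;
* `clas_real_arm_eq_prob` — TRANSLATION INVARIANCE: `P(HArm[b, m]) = θ(m)` for every base point `b`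
  (`real_openCrossing_shift`, `HalfPlaneArm.axisArm_eq`);
* `h19_conn_le_armSq` — the registered stub: the two half-boxes of radius `4n + 3` about `u` and `w`
  have `x`-ranges `[-8n-7, -1]` and `[1, 8n+7]`, so they are disjoint.
-/

noncomputable section

namespace Summit.CriticalPhenomena.CardyFormulaZ2.Cruxes.BoundaryDefectGaussianR.RainbowMonomialsInExcursionKernels

open MeasureTheory Set Literature.Probability.Percolation Literature.Probability.LatticeModels

local notation3 "hb[" b ", " m "]" =>
  {v : Site 2 | (b : Site 2) 1 ≤ v 1 ∧ max |v 0 - (b : Site 2) 0| (v 1 - (b : Site 2) 1) ≤ m}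
local notation3 "hl[" b ", " m "]" => {v : Site 2 | max |v 0 - (b : Site 2) 0| (v 1 - (b : Site 2) 1) = m}
local notation3 "HArm[" b ", " m "]" => openCrossing hb[b, m] {b} hl[b, m]
local notation3 "μ" => bondPercolation (zdGraph 2) half

/-! ### The half-plane norm from a base point -/

/-- The half-plane norm `max |v 0 - b 0| (v 1 - b 1)` seen from `b` moves by at most one along an
edge of `ℤ²`. [folklore] -/
theorem clas_norm_le_of_adj (b u v : Site 2) (h : (zdGraph 2).Adj u v) :
    max |v 0 - b 0| (v 1 - b 1) ≤ max |u 0 - b 0| (u 1 - b 1) + 1 :=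
  HalfPlaneArm.norm_le_of_adj (X := fun v : Site 2 => v 0) (Y := fun v : Site 2 => v 1)
    HalfPlaneArm.axis_X_le HalfPlaneArm.axis_Y_le b u v h

/-- The half-box `hb[b, m]` is finite (it lies in a coordinate box, and a site is determined by its
two coordinates). [folklore] -/
theorem clas_hb_finite (b : Site 2) (m : ℤ) : (hb[b, m]).Finite := by
  refine ((finite_Icc (b 0 - m, b 1) (b 0 + m, b 1 + m)).preimage
    HalfPlaneArm.axis_injective.injOn).subset fun v hv => ?_
  obtain ⟨h0, h1⟩ := hv
  rw [max_le_iff, abs_le] at h1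
  simp only [mem_preimage, mem_Icc, Prod.mk_le_mk]
  omega

/-! ### First exit: a connection leaving the half-box about its starting point contains an arm -/

/-- **First exit.** On a lattice configuration, an open path from `u` to `w` inside a region `S`
lying above the row of `u`, with `w` at half-plane distance `≥ m ≥ 0` from `u`, contains an arm from
`u` to the level `m` inside the half-box `hb[u, m]`: stop at the first visit to the level `m` of the
`1`-Lipschitz half-plane norm (`exists_openConnIn_le_level`). [folklore] -/
theorem clas_conn_mem_arm {ω : BondConfig (Site 2)} (hω : ω ⊆ (zdGraph 2).edgeSet) {S : Set (Site 2)}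
    {u w : Site 2} {m : ℤ} (hS : ∀ v ∈ S, u 1 ≤ v 1) (hm : 0 ≤ m)
    (hfar : m ≤ max |w 0 - u 0| (w 1 - u 1)) (h : ω ∈ openConnIn S u w) : ω ∈ HArm[u, m] := by
  obtain ⟨z, hz, hconn⟩ := exists_openConnIn_le_level hω
    (fun v : Site 2 => max |v 0 - u 0| (v 1 - u 1)) (clas_norm_le_of_adj u) m (by simp [hm]) hfar h
  refine ⟨u, mem_singleton u, z, hz, openConnIn_mono ?_ _ _ hconn⟩
  exact fun v hv => ⟨hS v hv.1, hv.2⟩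

/-- **Two arms.** On a lattice configuration, an open path inside a region `S` lying above the
common row of `u` and `w`, two points at half-plane distance `≥ m ≥ 0` from each other, contains an
arm from `u` to the level `m` inside `hb[u, m]` and (reversing the path) an arm from `w` to the level
`m` inside `hb[w, m]`. [folklore] -/
theorem clas_conn_mem_arm_inter {ω : BondConfig (Site 2)} (hω : ω ⊆ (zdGraph 2).edgeSet)
    {S : Set (Site 2)} {u w : Site 2} {m : ℤ} (hSu : ∀ v ∈ S, u 1 ≤ v 1) (hSw : ∀ v ∈ S, w 1 ≤ v 1)
    (hm : 0 ≤ m) (hfar : m ≤ max |w 0 - u 0| (w 1 - u 1)) (hfar' : m ≤ max |u 0 - w 0| (u 1 - w 1))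
    (h : ω ∈ openConnIn S u w) : ω ∈ HArm[u, m] ∩ HArm[w, m] :=
  ⟨clas_conn_mem_arm hω hSu hm hfar h, clas_conn_mem_arm hω hSw hm hfar' (HalfPlaneArm.conn_symm h)⟩

/-! ### Independence of arms in disjoint half-boxes -/

/-- **Independence of arms in disjoint half-boxes**: the two arm events are determined by the edges
inside the disjoint finite regions `hb[u, m]`, `hb[w, m']`, hence independent under the product
measure `P_{1/2}` (`bondPercolation_real_inter_of_disjoint`). [folklore] -/
theorem clas_real_arm_inter {u w : Site 2} {m m' : ℤ} (hdisj : Disjoint (hb[u, m]) (hb[w, m'])) :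
    (μ).real (HArm[u, m] ∩ HArm[w, m']) = (μ).real HArm[u, m] * (μ).real HArm[w, m'] :=
  bondPercolation_real_inter_of_disjoint (zdGraph 2) half (HalfPlaneArm.disjoint_pairs hdisj)
    (HalfPlaneArm.determinedBy_openCrossing_of_finite (clas_hb_finite u m) _ _)
    (HalfPlaneArm.determinedBy_openCrossing_of_finite (clas_hb_finite w m') _ _)
    (HalfPlaneArm.measurableSet_openCrossing_of_finite (clas_hb_finite u m) _ _)
    (HalfPlaneArm.measurableSet_openCrossing_of_finite (clas_hb_finite w m') _ _)

/-! ### Translation invariance: the arm probability from any base point is `θ(m)` -/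

/-- The half-box of `HalfPlaneArm.axisArm_eq` translated by `b` is `hb[b, m]`. [folklore] -/
theorem clas_image_add_hb (b : Site 2) (m : ℤ) :
    (· + b) '' {v : Site 2 | 0 ≤ v 1 ∧ max |v 0 - (0 : Site 2) 0| (v 1 - (0 : Site 2) 1) ≤ m} =
      hb[b, m] := by
  ext v
  simp only [mem_image, mem_setOf_eq, Pi.zero_apply, sub_zero]
  constructor
  · rintro ⟨x, ⟨h1, h2⟩, rfl⟩
    simp only [Pi.add_apply, add_sub_cancel_right]
    exact ⟨by omega, h2⟩
  · rintro ⟨h1, h2⟩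
    refine ⟨v - b, ⟨?_, ?_⟩, sub_add_cancel v b⟩
    · simp only [Pi.sub_apply]
      omega
    · simpa only [Pi.sub_apply] using h2

/-- The level set of `HalfPlaneArm.axisArm_eq` translated by `b` is `hl[b, m]`. [folklore] -/
theorem clas_image_add_hl (b : Site 2) (m : ℤ) :
    (· + b) '' {v : Site 2 | max |v 0 - (0 : Site 2) 0| (v 1 - (0 : Site 2) 1) = m} = hl[b, m] := by
  ext v
  simp only [mem_image, mem_setOf_eq, Pi.zero_apply, sub_zero]
  constructor
  · rintro ⟨x, hx, rfl⟩
    simpa only [Pi.add_apply, add_sub_cancel_right] using hx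
  · intro hv
    exact ⟨v - b, by simpa only [Pi.sub_apply] using hv, sub_add_cancel v b⟩

/-- The origin translated by `b` is `b`. [folklore] -/
theorem clas_image_add_zero (b : Site 2) : (· + b) '' ({0} : Set (Site 2)) = {b} := by
  rw [image_singleton, zero_add]

/-- **Translation invariance**: for every base point `b` and `m : ℕ`, the probability of an arm from
`b` to half-plane distance `m` inside `hb[b, m]` is `θ(m) = prob half m`, the half-plane one-arm
probability of the crux `HalfPlaneOneArmThird` (`real_openCrossing_shift`, translation invariance of
`P_p`, and `HalfPlaneArm.axisArm_eq`). [folklore] -/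
theorem clas_real_arm_eq_prob (b : Site 2) (m : ℕ) :
    (μ).real HArm[b, (m : ℤ)] =
      Summit.CriticalPhenomena.CardyFormulaZ2.Theorems.HalfPlaneOneArmThird.Negative.prob half m := by
  simp only [Summit.CriticalPhenomena.CardyFormulaZ2.Theorems.HalfPlaneOneArmThird.Negative.prob,
    Summit.CriticalPhenomena.CardyFormulaZ2.Theorems.HalfPlaneOneArmThird.Negative.armEvt,
    Summit.CriticalPhenomena.CardyFormulaZ2.Theorems.HalfPlaneOneArmThird.Negative.halfBox]
  rw [HalfPlaneArm.axisArm_eq, ← clas_image_add_hb b, ← clas_image_add_zero b, ← clas_image_add_hl b,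
    real_openCrossing_shift]

/-! ### The two-point bound -/

/-- **Two-point connection versus two arms.** For the box `[-N, N]²`, two points `u`, `w` of its
bottom row with `u 0 = -4(n+1)`, `w 0 = 4(n+1)`: `P[u ↔ w inside the box] ≤ θ(4n + 3)²` — the
connection contains arms in the two half-boxes of radius `4n + 3` about `u` and `w`
(`clas_conn_mem_arm_inter`), which are disjoint (`x`-ranges `[-8n-7, -1]` and `[1, 8n+7]`), hence
independent (`clas_real_arm_inter`), each of probability `θ(4n + 3)` (`clas_real_arm_eq_prob`).
[folklore] -/
theorem clas_conn_le_armSq (n : ℕ) (N : ℤ) (u w : Site 2) (hu0 : u 0 = -(4 * ((n : ℤ) + 1)))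
    (hu1 : u 1 = -N) (hw0 : w 0 = 4 * ((n : ℤ) + 1)) (hw1 : w 1 = -N) :
    (μ).real (openConnIn {v : Site 2 | (-N ≤ v 0 ∧ v 0 ≤ N) ∧ (-N ≤ v 1 ∧ v 1 ≤ N)} u w) ≤
      (Summit.CriticalPhenomena.CardyFormulaZ2.Theorems.HalfPlaneOneArmThird.Negative.prob half
          (4 * n + 3)) ^ 2 := by
  have hm : (0 : ℤ) ≤ ((4 * n + 3 : ℕ) : ℤ) := by positivity
  have hfar : ((4 * n + 3 : ℕ) : ℤ) ≤ max |w 0 - u 0| (w 1 - u 1) := by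
    refine le_max_of_le_left ?_
    rw [hu0, hw0, abs_of_nonneg (by omega)]
    push_cast
    omega
  have hfar' : ((4 * n + 3 : ℕ) : ℤ) ≤ max |u 0 - w 0| (u 1 - w 1) := by
    refine le_max_of_le_left ?_
    rw [hu0, hw0, abs_of_nonpos (by omega)]
    push_cast
    omega
  have hSu : ∀ v ∈ {v : Site 2 | (-N ≤ v 0 ∧ v 0 ≤ N) ∧ (-N ≤ v 1 ∧ v 1 ≤ N)}, u 1 ≤ v 1 :=
    fun v hv => by rw [hu1]; exact hv.2.1
  have hSw : ∀ v ∈ {v : Site 2 | (-N ≤ v 0 ∧ v 0 ≤ N) ∧ (-N ≤ v 1 ∧ v 1 ≤ N)}, w 1 ≤ v 1 :=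
    fun v hv => by rw [hw1]; exact hv.2.1
  have hdisj : Disjoint (hb[u, ((4 * n + 3 : ℕ) : ℤ)]) (hb[w, ((4 * n + 3 : ℕ) : ℤ)]) := by
    rw [Set.disjoint_left]
    rintro v ⟨-, hv⟩ ⟨-, hv'⟩
    rw [max_le_iff, abs_le, hu0] at hv
    rw [max_le_iff, abs_le, hw0] at hv'
    push_cast at hv hv'
    omega
  calc (μ).real (openConnIn {v : Site 2 | (-N ≤ v 0 ∧ v 0 ≤ N) ∧ (-N ≤ v 1 ∧ v 1 ≤ N)} u w)
      ≤ (μ).real (HArm[u, ((4 * n + 3 : ℕ) : ℤ)] ∩ HArm[w, ((4 * n + 3 : ℕ) : ℤ)]) := by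
        refine ENNReal.toReal_mono (measure_ne_top _ _) (measure_mono_ae ?_)
        filter_upwards [ae_subset_edgeSet (zdGraph 2) half] with ω hω h
        exact clas_conn_mem_arm_inter hω hSu hSw hm hfar hfar' h
    _ = (μ).real HArm[u, ((4 * n + 3 : ℕ) : ℤ)] * (μ).real HArm[w, ((4 * n + 3 : ℕ) : ℤ)] :=
        clas_real_arm_inter hdisj
    _ = (Summit.CriticalPhenomena.CardyFormulaZ2.Theorems.HalfPlaneOneArmThird.Negative.prob half
          (4 * n + 3)) ^ 2 := by
        rw [clas_real_arm_eq_prob, clas_real_arm_eq_prob, sq]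

/-! ### Registered stub H3 -/

/-- **Stub H3.** `P_{1/2}[(-4(n+1),-12(n+1)) ↔ (4(n+1),-12(n+1)) in V_n] ≤ θ(4n+3)²`, `θ(m)` the half-plane
one-arm probability of crux 6: an open path between the two bottom-row points contains, by first exit, an arm
in each of the two disjoint half-boxes of radius `4n+3` about them (translates of the half-box of `armEvt`),
and events determined by disjoint edge sets are independent. [folklore] -/
theorem h19_conn_le_armSq : ∀ n : ℕ,
    (Literature.Probability.Percolation.bondPercolation (Literature.Probability.LatticeModels.zdGraph 2)
          Literature.Probability.Percolation.half).real
        (Literature.Probability.Percolation.openConnIn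
          {v : Literature.Probability.LatticeModels.Site 2 |
            (-(12 * ((n : ℤ) + 1)) ≤ v 0 ∧ v 0 ≤ 12 * ((n : ℤ) + 1)) ∧
              (-(12 * ((n : ℤ) + 1)) ≤ v 1 ∧ v 1 ≤ 12 * ((n : ℤ) + 1))}
          (![-(4 * ((n : ℤ) + 1)), -(12 * ((n : ℤ) + 1))] : Literature.Probability.LatticeModels.Site 2)
          (![4 * ((n : ℤ) + 1), -(12 * ((n : ℤ) + 1))] : Literature.Probability.LatticeModels.Site 2)) ≤
      (Summit.CriticalPhenomena.CardyFormulaZ2.Theorems.HalfPlaneOneArmThird.Negative.prob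
          Literature.Probability.Percolation.half (4 * n + 3)) ^ 2 :=
  fun n => clas_conn_le_armSq n (12 * ((n : ℤ) + 1)) _ _ rfl rfl rfl rfl

end Summit.CriticalPhenomena.CardyFormulaZ2.Cruxes.BoundaryDefectGaussianR.RainbowMonomialsInExcursionKernels

end
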